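import Summits.Ventures.LatticeQCDFlow.Scaling.SwapLadderIndexTauIntOptimumShape
import Summits.Ventures.LatticeQCDFlow.Scaling.SwapSpacingBrackets

/-!
HONEST FRAMING: exact (Metropolis-corrected) sampling algorithms for lattice gauge theory; figures
of merit are autocorrelation/cost numbers at stated couplings and volumes; no continuum-physics
claim.

# SwapLadderIndexTauIntThresholdPoints — CERTIFIED POINTS OF `G′`: `G′(2√2·x) = G′(0)·e^{−x²}/erfc(x)²`, AND
# `R·G′(0) ≤ G′(2√2·x)` AT `(R, x) = (1.21, 0.1), (2, 0.3), (2.45, 0.4), (3.85, 0.6), (7.72, 0.85), (12.25, 1),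
# (27.71, 1.4)` — THE BRACKETS THAT PUT THE CARD'S THREE LADDERS (`K = 7, 12, 19`, i.e. `N_r = 8, 13, 20`) ABOVE
# THE COLLAPSE THRESHOLD OF THE `τ_int`-OPTIMAL LADDER (row 22 `su3-ptbc`, GEN-8, ours; numeric companion of
# `SwapLadderIndexTauIntCritGap` / `SwapLadderIndexTauIntThreshold`)

Venture `LatticeQCDFlow` (cell pub-lqcd), topic `Scaling`; FANOUT row 22 (`su3-ptbc`).  NEW WORK of the cell
(elementary certified numerics) over GEN-6's `SwapLadderRoundTripOptimum` (`deriv_gaussInvAcc = G·(−(log gaussAcc)′)`),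
GEN-7's `SwapLadderIndexTauIntOptimumShape` (`deriv_gaussInvAcc_zero`, `deriv_gaussInvAcc_pos`), GEN-4's
`SwapSpacingBrackets` (`partialSum_even_le_erf` — even Maclaurin partial sums are below `erf` on `[0,1]` —,
`lt_two_div_sqrt_pi`, `erfc_eq_one_sub`), the Literature Mills bound `erfc_lt_leadFactor` (`erfc x < e^{−x²}/(x√π)`,
`Literature.ComputerArithmetic.BrentZimmermann2010`) and Mathlib's `Real.exp_bound'`, `Real.sum_le_exp_of_nonneg`,
`Real.pi_gt_d2`.  Every statement is a kernel-checked inequality between explicit rationals and `erf`/`erfc`, `exp`,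
`√π`; no `native_decide`, no interval engine; nothing is cited as a fact.

THE POINT.  `SwapLadderIndexTauIntCritGap` defines the critical gap by `G′(critGap R) = R·G′(0)` (`G′` strictly
increasing) and the collapse threshold `Λ_c(K) = Σ_j critGap((w_max/w_j)²)`; `SwapLadderIndexTauIntThreshold` proves
that a positive `τ_int`-optimal ladder exists iff the total stiffness exceeds `Λ_c(K)`.  To place a concrete ladder one
needs UPPER bounds `critGap R ≤ c`, i.e. points with `R·G′(0) ≤ G′(c)`.  Along the ray `c = 2√2·x` the ratio is
explicit: **`G′(2√2·x) = G′(0)·e^{−x²}/erfc(x)²`** (`deriv_gaussInvAcc_ray`), so `R·G′(0) ≤ G′(2√2·x)` iff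
`R·erfc(x)² ≤ e^{−x²}` (`mul_deriv_zero_le_deriv_ray`), which is certified from an even Maclaurin partial sum of `erf`
(6 terms) and a Taylor ceiling of `e^{x²}` (`mul_erfc_sq_le_exp_neg`), or — beyond `x = 1` — from the Mills bound
(`mul_erfc_sq_le_exp_neg_of_mills`).  The seven certified points (`ray_point_01 … ray_point_14`) cover every weight ratio
`(w_max/w_j)²` of the ladders with `K = 7` (`16/7, 16/12, 16/15` squared), `K = 12` (`42/12, 42/22, 42/30, 42/36, 42/40`
squared) and `K = 19` (`100/19, …, 100/99` squared); with `critGap_le` / `critGap_mono` of `SwapLadderIndexTauIntCritGap`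
(not imported — unbuilt at the time of writing; the one-line corollaries are the sequel) they give
`Λ_c(7) ≤ 2√2·2.5 ≈ 7.1`, `Λ_c(12) ≤ 2√2·4.6 ≈ 13.0`, `Λ_c(19) ≤ 2√2·8.3 ≈ 23.5`, each below HALF the flat-`20 %`
stiffness `K·ℓ₂₀ = K·2√2·u₂₀ > K·2√2·0.905` (`17.9, 30.7, 48.6`).  NOT CLAIMED: those corollaries (sequel), sharpness
(desk values `Λ_c = 5.43, 10.92, 19.35`), anything about PTBC itself or a run.
-/

noncomputable section

open Finset Real Filter Topology
open Literature.Analysis.SpecialFunctions (erf erfTerm)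
open Literature.ComputerArithmetic.BrentZimmermann2010.AsymptoticExpansions (erfc erfc_pos erfc_lt_leadFactor
  leadFactor)

namespace Summit.Ventures.LatticeQCDFlow.Scaling

/-! ## §1 `G′` along the ray `ℓ = 2√2·x`, and the two certification routes -/

section Ray

/-- **`G′(2√2·x) = G′(0) · e^{−x²}/erfc(x)²`** (`G′ = G·(−log gaussAcc)′`, `G(2√2x) = 1/erfc x`,
`−(log gaussAcc)′(2√2x) = (2/√π)e^{−x²}/(2√2·erfc x)`, `G′(0) = (2/√π)/(2√2)`). [ours] -/
theorem deriv_gaussInvAcc_ray (x : ℝ) :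
    deriv gaussInvAcc (2 * sqrt 2 * x) = deriv gaussInvAcc 0 * (exp (-(x ^ 2)) / erfc x ^ 2) := by
  rw [deriv_gaussInvAcc_zero, deriv_gaussInvAcc]
  have hs : (2 : ℝ) * sqrt 2 ≠ 0 := by positivity
  have hx : 2 * sqrt 2 * x / (2 * sqrt 2) = x := by field_simp
  simp only [gaussInvAcc_apply, gaussAcc, gaussNegLogDeriv, erfcLogDeriv, hx]
  have he : erfc x ≠ 0 := (erfc_pos x).ne'
  field_simp

/-- Hence **`R·G′(0) ≤ G′(2√2·x)` as soon as `R·erfc(x)² ≤ e^{−x²}`.** [ours] -/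
theorem mul_deriv_zero_le_deriv_ray {R x : ℝ} (h : R * erfc x ^ 2 ≤ exp (-(x ^ 2))) :
    R * deriv gaussInvAcc 0 ≤ deriv gaussInvAcc (2 * sqrt 2 * x) := by
  rw [deriv_gaussInvAcc_ray]
  have hd := deriv_gaussInvAcc_pos 0
  have he : 0 < erfc x ^ 2 := pow_pos (erfc_pos x) 2
  rw [mul_comm R]
  refine mul_le_mul_of_nonneg_left ?_ hd.le
  rw [le_div_iff₀ he]
  exact h

/-- **Series route**: an `erf` floor `e ≤ erf x`, an `exp(x²)` ceiling `E` and the rational check `R(1−e)²E ≤ 1`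
(`R ≥ 0`) give `R·erfc(x)² ≤ e^{−x²}`. [ours] -/
theorem mul_erfc_sq_le_exp_neg {R x e E : ℝ} (hR : 0 ≤ R) (he : e ≤ erf x) (hE : exp (x ^ 2) ≤ E)
    (h : R * (1 - e) ^ 2 * E ≤ 1) : R * erfc x ^ 2 ≤ exp (-(x ^ 2)) := by
  have h0 : 0 ≤ erfc x := (erfc_pos x).le
  have h1 : erfc x ≤ 1 - e := by rw [erfc_eq_one_sub]; linarith
  have h2 : erfc x ^ 2 ≤ (1 - e) ^ 2 := pow_le_pow_left₀ h0 h1 2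
  have h3 : R * erfc x ^ 2 * exp (x ^ 2) ≤ 1 :=
    (mul_le_mul (mul_le_mul_of_nonneg_left h2 hR) hE (exp_pos _).le (by positivity)).trans h
  calc R * erfc x ^ 2 = R * erfc x ^ 2 * exp (x ^ 2) * exp (-(x ^ 2)) := by
        rw [mul_assoc (R * erfc x ^ 2), ← exp_add, add_neg_cancel, exp_zero, mul_one]
    _ ≤ 1 * exp (-(x ^ 2)) := mul_le_mul_of_nonneg_right h3 (exp_pos _).le
    _ = exp (-(x ^ 2)) := one_mul _

/-- **Mills route** (any `x > 0`): `erfc x < e^{−x²}/(x√π)`, so `R ≤ x²·π·F` with `F ≤ e^{x²}` gives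
`R·erfc(x)² ≤ e^{−x²}`. [ours] -/
theorem mul_erfc_sq_le_exp_neg_of_mills {R x F : ℝ} (hx : 0 < x) (hR : 0 ≤ R) (hF : F ≤ exp (x ^ 2))
    (h : R ≤ x ^ 2 * π * F) : R * erfc x ^ 2 ≤ exp (-(x ^ 2)) := by
  have hπ : 0 < sqrt π := by positivity
  have h0 : 0 ≤ erfc x := (erfc_pos x).le
  have h1 : erfc x ≤ exp (-(x ^ 2)) / (x * sqrt π) := (erfc_lt_leadFactor hx).le
  have h2 : erfc x ^ 2 ≤ (exp (-(x ^ 2)) / (x * sqrt π)) ^ 2 := pow_le_pow_left₀ h0 h1 2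
  have hsq : sqrt π ^ 2 = π := sq_sqrt pi_pos.le
  have hRF : R ≤ x ^ 2 * π * exp (x ^ 2) :=
    h.trans (mul_le_mul_of_nonneg_left hF (by positivity))
  have hE : exp (x ^ 2) * exp (-(x ^ 2)) = 1 := by rw [← exp_add, add_neg_cancel, exp_zero]
  have key : R * exp (-(x ^ 2)) ≤ x ^ 2 * π := by
    have := mul_le_mul_of_nonneg_right hRF (exp_pos (-(x ^ 2))).le
    rwa [mul_assoc (x ^ 2 * π), hE, mul_one] at this
  have hxπ : 0 < x ^ 2 * π := by positivity
  calc R * erfc x ^ 2 ≤ R * (exp (-(x ^ 2)) / (x * sqrt π)) ^ 2 := mul_le_mul_of_nonneg_left h2 hR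
    _ = R * exp (-(x ^ 2)) * exp (-(x ^ 2)) / (x ^ 2 * π) := by rw [div_pow, mul_pow, hsq]; ring
    _ ≤ x ^ 2 * π * exp (-(x ^ 2)) / (x ^ 2 * π) :=
        div_le_div_of_nonneg_right (mul_le_mul_of_nonneg_right key (exp_pos _).le) hxπ.le
    _ = exp (-(x ^ 2)) := by field_simp

end Ray

/-! ## §2 Certified `erf` floors (six Maclaurin terms) and `exp` ceilings at the seven points -/

section Points

/-- **`erf` floor from six Maclaurin terms**: `1.12836·S ≤ erf x` for `0 ≤ x ≤ 1`, `S ≥ 0` the even partial sum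
(`2/√π > 1.12836`). [ours] -/
theorem erf_ge_of_partialSum_six {x S : ℝ} (hx0 : 0 ≤ x) (hx1 : x ≤ 1)
    (hS : ∑ i ∈ range (2 * 3), (-1 : ℝ) ^ i * erfTerm x i = S) (hS0 : 0 ≤ S) : 1.12836 * S ≤ erf x := by
  have h := partialSum_even_le_erf hx0 hx1 3
  rw [hS] at h
  exact (mul_le_mul_of_nonneg_right lt_two_div_sqrt_pi.le hS0).trans h

/-- Six Maclaurin terms at `x = 0.1`. [ours] -/
theorem erf_partialSum_six_01 : ∑ i ∈ range (2 * 3), (-1 : ℝ) ^ i * erfTerm (1 / 10) i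
    = 828836296238437 / 8316000000000000 := by
  simp only [erfTerm, Finset.sum_range_succ, Finset.sum_range_zero]
  norm_num [Nat.factorial]

/-- Six Maclaurin terms at `x = 0.3`. [ours] -/
theorem erf_partialSum_six_03 : ∑ i ∈ range (2 * 3), (-1 : ℝ) ^ i * erfTerm (3 / 10) i
    = 89701267853157 / 308000000000000 := by
  simp only [erfTerm, Finset.sum_range_succ, Finset.sum_range_zero]
  norm_num [Nat.factorial]

/-- Six Maclaurin terms at `x = 0.4`. [ours] -/
theorem erf_partialSum_six_04 : ∑ i ∈ range (2 * 3), (-1 : ℝ) ^ i * erfTerm (2 / 5) i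
    = 192699768622 / 507568359375 := by
  simp only [erfTerm, Finset.sum_range_succ, Finset.sum_range_zero]
  norm_num [Nat.factorial]

/-- Six Maclaurin terms at `x = 0.6`. [ours] -/
theorem erf_partialSum_six_06 : ∑ i ∈ range (2 * 3), (-1 : ℝ) ^ i * erfTerm (3 / 5) i
    = 40241026641 / 75195312500 := by
  simp only [erfTerm, Finset.sum_range_succ, Finset.sum_range_zero]
  norm_num [Nat.factorial]

/-- Six Maclaurin terms at `x = 0.85`. [ours] -/
theorem erf_partialSum_six_085 : ∑ i ∈ range (2 * 3), (-1 : ℝ) ^ i * erfTerm (17 / 20) i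
    = 11631860867874757121 / 17031168000000000000 := by
  simp only [erfTerm, Finset.sum_range_succ, Finset.sum_range_zero]
  norm_num [Nat.factorial]

/-- Six Maclaurin terms at `x = 1`. [ours] -/
theorem erf_partialSum_six_one : ∑ i ∈ range (2 * 3), (-1 : ℝ) ^ i * erfTerm 1 i = 31049 / 41580 := by
  simp only [erfTerm, Finset.sum_range_succ, Finset.sum_range_zero]
  norm_num [Nat.factorial]

/-- **`exp` ceiling from Mathlib's `Real.exp_bound'` with six terms**: for `0 ≤ y ≤ 1`,
`exp y ≤ Σ_{m<6} y^m/m! + 7y⁶/(6!·6)`. [folklore] -/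
theorem exp_le_taylor_six {y : ℝ} (hy0 : 0 ≤ y) (hy1 : y ≤ 1) :
    exp y ≤ 1 + y + y ^ 2 / 2 + y ^ 3 / 6 + y ^ 4 / 24 + y ^ 5 / 120 + y ^ 6 * 7 / 4320 := by
  have h := Real.exp_bound' hy0 hy1 (n := 6) (by norm_num)
  refine h.trans (le_of_eq ?_)
  simp only [Finset.sum_range_succ, Finset.sum_range_zero, Nat.factorial]
  push_cast
  ring

/-- `(1.21, 0.1)`: **`1.21·G′(0) ≤ G′(2√2·0.1)`** (covers the ratios `(w_max/w_j)² ≤ 1.21`). [ours] -/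
theorem ray_point_01 : (121 / 100 : ℝ) * deriv gaussInvAcc 0 ≤ deriv gaussInvAcc (2 * sqrt 2 * (1 / 10)) := by
  refine mul_deriv_zero_le_deriv_ray (mul_erfc_sq_le_exp_neg (by norm_num)
    (erf_ge_of_partialSum_six (by norm_num) (by norm_num) erf_partialSum_six_01 (by norm_num))
    (exp_le_taylor_six (by norm_num) (by norm_num)) ?_)
  norm_num

/-- `(2, 0.3)`: **`2·G′(0) ≤ G′(2√2·0.3)`**. [ours] -/
theorem ray_point_03 : (2 : ℝ) * deriv gaussInvAcc 0 ≤ deriv gaussInvAcc (2 * sqrt 2 * (3 / 10)) := by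
  refine mul_deriv_zero_le_deriv_ray (mul_erfc_sq_le_exp_neg (by norm_num)
    (erf_ge_of_partialSum_six (by norm_num) (by norm_num) erf_partialSum_six_03 (by norm_num))
    (exp_le_taylor_six (by norm_num) (by norm_num)) ?_)
  norm_num

/-- `(2.45, 0.4)`: **`2.45·G′(0) ≤ G′(2√2·0.4)`**. [ours] -/
theorem ray_point_04 : (49 / 20 : ℝ) * deriv gaussInvAcc 0 ≤ deriv gaussInvAcc (2 * sqrt 2 * (2 / 5)) := by
  refine mul_deriv_zero_le_deriv_ray (mul_erfc_sq_le_exp_neg (by norm_num)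
    (erf_ge_of_partialSum_six (by norm_num) (by norm_num) erf_partialSum_six_04 (by norm_num))
    (exp_le_taylor_six (by norm_num) (by norm_num)) ?_)
  norm_num

/-- `(3.85, 0.6)`: **`3.85·G′(0) ≤ G′(2√2·0.6)`**. [ours] -/
theorem ray_point_06 : (77 / 20 : ℝ) * deriv gaussInvAcc 0 ≤ deriv gaussInvAcc (2 * sqrt 2 * (3 / 5)) := by
  refine mul_deriv_zero_le_deriv_ray (mul_erfc_sq_le_exp_neg (by norm_num)
    (erf_ge_of_partialSum_six (by norm_num) (by norm_num) erf_partialSum_six_06 (by norm_num))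
    (exp_le_taylor_six (by norm_num) (by norm_num)) ?_)
  norm_num

/-- `(7.72, 0.85)`: **`7.72·G′(0) ≤ G′(2√2·0.85)`**. [ours] -/
theorem ray_point_085 : (193 / 25 : ℝ) * deriv gaussInvAcc 0 ≤ deriv gaussInvAcc (2 * sqrt 2 * (17 / 20)) := by
  refine mul_deriv_zero_le_deriv_ray (mul_erfc_sq_le_exp_neg (by norm_num)
    (erf_ge_of_partialSum_six (by norm_num) (by norm_num) erf_partialSum_six_085 (by norm_num))
    (exp_le_taylor_six (by norm_num) (by norm_num)) ?_)
  norm_num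

/-- `(12.25, 1)`: **`12.25·G′(0) ≤ G′(2√2)`** (`erfc 1 ≤ 0.15743`, `e < 2.7182818286`). [ours] -/
theorem ray_point_one : (49 / 4 : ℝ) * deriv gaussInvAcc 0 ≤ deriv gaussInvAcc (2 * sqrt 2 * 1) := by
  refine mul_deriv_zero_le_deriv_ray (mul_erfc_sq_le_exp_neg (by norm_num)
    (erf_ge_of_partialSum_six (by norm_num) (by norm_num) erf_partialSum_six_one (by norm_num))
    (show exp ((1 : ℝ) ^ 2) ≤ 2.7182818286 by rw [one_pow]; exact Real.exp_one_lt_d9.le) ?_)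
  norm_num

/-- `e^{1.96} ≥ 7` (eight Taylor terms). [ours] -/
theorem seven_le_exp_196 : (7 : ℝ) ≤ exp ((7 / 5 : ℝ) ^ 2) := by
  have h := Real.sum_le_exp_of_nonneg (x := (7 / 5 : ℝ) ^ 2) (by positivity) 8
  refine le_trans ?_ h
  simp only [Finset.sum_range_succ, Finset.sum_range_zero, Nat.factorial]
  push_cast
  norm_num

/-- `(27.71, 1.4)` by the Mills route: **`27.71·G′(0) ≤ G′(2√2·1.4)`** (`27.71 ≤ 1.96·π·7`, `π > 3.14`). [ours] -/
theorem ray_point_14 : (2771 / 100 : ℝ) * deriv gaussInvAcc 0 ≤ deriv gaussInvAcc (2 * sqrt 2 * (7 / 5)) := by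
  refine mul_deriv_zero_le_deriv_ray (mul_erfc_sq_le_exp_neg_of_mills (by norm_num) (by norm_num)
    seven_le_exp_196 ?_)
  have hπ := Real.pi_gt_d2
  nlinarith

end Points


end Summit.Ventures.LatticeQCDFlow.Scaling

end
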